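import Literature.AnabelianGeometry.EtaleTheta.Discharge.Sec5TowerOfConnectedTemperoidYddFacts

/-!
# [EtTh] §5 tower over `B^temp(Π^tp_X)⁰` with `A_⊙^bs := Ÿ`: at the levels `M ∈ E`, `Facts` from `hconst` and `hgc` alone (Lemma 5.8, p.331 / PDF p.105)

Mochizuki, *The étale theta function …*, Publ. RIMS **45** (2009) [cite: MochizukiEtTh2009, Lem 5.8 p.331 (PDF p.105); §5 p.330–331 (PDF pp.104–105)].
Seat abc-iut-L2-t4 (§5 owner), ROW W3-L2-01 «§5 GENUINE DATA»; PROOF-ONLY corollary of `Discharge/Sec5TowerOfConnectedTemperoidYddFacts.lean`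
(p428098) and `Discharge/Sec5InvariantUnitsOfBiratAction.lean` (p421221).  Additive.

At a level `M ∈ E` the tower's data ARE the one-level §5 data (`atLevel_ofConnectedTemperoidFamily_eq`, definitionally), so Lemma 5.8's
`ConstantsActByCyclotome` follows there from the constants-fixed law `hconst` (Def. 3.6 (iii)) and the geometric-connectedness input
`hgc` through abc-iut-L2-t11's natural action (`constantsActByCyclotome_ofModelData`); with `hH` a theorem for `A_⊙^bs := Ÿ`,
`Facts` at such a level needs `hconst`, `hgc` ALONE:
* `ThetaFrobenioidTower.constantsActByCyclotome_atLevel_ofConnectedTemperoidYddTower` (level `M ∈ E`);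
* `ThetaFrobenioidTower.facts_atLevel_mem_ofConnectedTemperoidYddTower` (level `M ∈ E`; inputs `hconst`, `hgc`).
HONEST FRAMING: kernel-checked implications over abc-iut-L2-t3's / abc-iut-L3's data structures; no side taken downstream.
-/

noncomputable section

namespace Literature.AnabelianGeometry.EtaleTheta

open CategoryTheory Opposite Literature.AlgebraicGeometry.Frobenioids Literature.AnabelianGeometry.SemiGraphs
  Literature.AnabelianGeometry.SemiGraphs.GaloisObjects

universe u₀ v₀ w

namespace ThetaFrobenioidTower

variable {K : Type u₀} [Field K] {X : SemiGraphs.TemperedArithmeticGroup.{u₀} K} {D₀ : Type u₀} [Category.{v₀} D₀]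
  {V : FrdIMonoidStub.{w}} {T₀ : RealifiedDivisorMonoids (D₀ := D₀) V}
  {VD : FrdICatStub.{u₀ + 1, u₀, w} (ConnectedPart (BTemp X.Pi))}
  {tf : TemperedFrobenioid T₀ (ConnectedPart (BTemp X.Pi)) VD} {hZ : tf.monoidType = MonoidType.Z}
  {hP : ∀ A : (ConnectedPart (BTemp X.Pi))ᵒᵖ, IsPerfect (tf.Φ.carrier A)}
  {NH : Subgroup (Field.absoluteGaloisGroup K) → tf.category → ℕ+ → Prop}
  {lv : ℕ+} {E : Set ℕ+} {𝒯 : ThetaEnvTower.{max u₀ w} E} {ιX : 𝒯.PiX ≃ₜ* X.Pi}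
  {pullFrac : ∀ {A A' : (BiKummerSetting.mkOfConnectedTemperoidYddTower X tf hZ hP NH 𝒯 ιX).C} (_ : A' ⟶ A),
    (BiKummerSetting.mkOfConnectedTemperoidYddTower X tf hZ hP NH 𝒯 ιX).biratUnits A →
      (BiKummerSetting.mkOfConnectedTemperoidYddTower X tf hZ hP NH 𝒯 ιX).biratUnits A'}
  {θ : (BiKummerSetting.mkOfConnectedTemperoidYddTower X tf hZ hP NH 𝒯 ιX).biratUnits
    (BiKummerSetting.mkOfConnectedTemperoidYddTower X tf hZ hP NH 𝒯 ιX).Aodot}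
  {Bl : (BiKummerSetting.mkOfConnectedTemperoidYddTower X tf hZ hP NH 𝒯 ιX).C}
  {Pl : (BiKummerSetting.mkOfConnectedTemperoidYddTower X tf hZ hP NH 𝒯 ιX).FractionPair θ Bl}
  {Rl : (BiKummerSetting.mkOfConnectedTemperoidYddTower X tf hZ hP NH 𝒯 ιX).NthRoot θ Pl lv pullFrac}
  (h : ModelFrobenioid.Hypotheses tf.divisorMonoid tf.ratFnFunctor)
  (Q : FrobenioidTheta.ThetaSubquotientStub.{w} (ConnectedPart (BTemp X.Pi))) (odd_l : Odd (lv : ℕ))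
  (R : ∀ N : ℕ+, (BiKummerSetting.mkOfConnectedTemperoidYddTower X tf hZ hP NH 𝒯 ιX).NthRoot Rl.root Rl.pair N pullFrac)
  (K' : Type w) [Field K'] (constEmb : ∀ N : ℕ+, K'ˣ →* tf.biratUnitsModel (R N).BN)
  (constEmb_injective : ∀ N : ℕ+, Function.Injective (constEmb N))
  (hinvc : ∀ (N : ℕ+) (g : Aut (R N).AN.base),
    pull tf.divisorMonoid g.hom (ModelFrobenioid.div (R N).pair.num) = ModelFrobenioid.div (R N).pair.num)
  (hinvp : ∀ (N : ℕ+) (y : 𝒯.PiX), y ∈ 𝒯.PiYdd →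
    pull tf.divisorMonoid ((BiKummerSetting.mkOfConnectedTemperoidYddTower X tf hZ hP NH 𝒯 ιX).galoisSurj (R N).AN.base
      (R N).αData.isGalois (ιX y)).hom (ModelFrobenioid.div (R N).pair.den) = ModelFrobenioid.div (R N).pair.den)
  (α : ∀ {N N' : ℕ+}, (N : ℕ) ∣ N' → ((R N').AN ⟶ (R N).AN))
  (β : ∀ {N N' : ℕ+}, (N : ℕ) ∣ N' → ((R N').BN ⟶ (R N).BN))
  (comm_sCap : ∀ {N N' : ℕ+} (hd : (N : ℕ) ∣ N'), (R N').pair.num ≫ β hd = α hd ≫ (R N).pair.num)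
  (comm_sCup : ∀ {N N' : ℕ+} (hd : (N : ℕ) ∣ N'), (R N').pair.den ≫ β hd = α hd ≫ (R N).pair.den)
  (isIsometry_α : ∀ {N N' : ℕ+} (hd : (N : ℕ) ∣ N'),
    ((BiKummerSetting.mkOfConnectedTemperoidYddTower X tf hZ hP NH 𝒯 ιX).sec5Stub h).pre.IsIsometry (α hd))
  (degFr_α : ∀ {N N' : ℕ+} (hd : (N : ℕ) ∣ N'),
    (((BiKummerSetting.mkOfConnectedTemperoidYddTower X tf hZ hP NH 𝒯 ιX).sec5Stub h).pre.degFr (α hd) : ℕ) * N = N')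
  (isIsometry_β : ∀ {N N' : ℕ+} (hd : (N : ℕ) ∣ N'),
    ((BiKummerSetting.mkOfConnectedTemperoidYddTower X tf hZ hP NH 𝒯 ιX).sec5Stub h).pre.IsIsometry (β hd))
  (degFr_β : ∀ {N N' : ℕ+} (hd : (N : ℕ) ∣ N'),
    (((BiKummerSetting.mkOfConnectedTemperoidYddTower X tf hZ hP NH 𝒯 ιX).sec5Stub h).pre.degFr (β hd) : ℕ) * N = N')
  (baseFrob_α : ∀ {N N' : ℕ+} (hd : (N : ℕ) ∣ N'),
    (BiKummerSetting.mkOfConnectedTemperoidYddTower X tf hZ hP NH 𝒯 ιX).IsOfBaseFrobeniusType (α hd))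

/-- **Lemma 5.8's `ConstantsActByCyclotome` at a level `M ∈ E` of the tower over `B^temp(Π^tp_X)⁰` (`A_⊙^bs := Ÿ`)** from the
constants-fixed law `hconst` (Def. 3.6 (iii)) and the geometric-connectedness input `hgc` (abc-iut-L2-t11's natural action via
`constantsActByCyclotome_ofModelData`; the level IS the one-level data, definitionally).  [cite: MochizukiEtTh2009, Lem 5.8 p.331 (PDF p.105)] -/
theorem constantsActByCyclotome_atLevel_ofConnectedTemperoidYddTower (M : E)
    (hconst : ∀ (e : Aut (R M).BN) (k : K'ˣ), tf.biratAutModel (R M).BN e (constEmb M k) = constEmb M k)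
    (hgc : ∀ u : ((ofConnectedTemperoidFamily h Q odd_l R ιX K' constEmb constEmb_injective hinvc hinvp α β comm_sCap comm_sCup
      isIsometry_α degFr_α isIsometry_β degFr_β baseFrob_α).atLevel M).units ((ofConnectedTemperoidFamily h Q odd_l R ιX K' constEmb constEmb_injective hinvc hinvp α β comm_sCap comm_sCup
      isIsometry_α degFr_α isIsometry_β degFr_β baseFrob_α).atLevel M).BN,
      (∀ y ∈ ((ofConnectedTemperoidFamily h Q odd_l R ιX K' constEmb constEmb_injective hinvc hinvp α β comm_sCap comm_sCup
      isIsometry_α degFr_α isIsometry_β degFr_β baseFrob_α).atLevel M).imPiY,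
        ((ofConnectedTemperoidFamily h Q odd_l R ιX K' constEmb constEmb_injective hinvc hinvp α β comm_sCap comm_sCup
      isIsometry_α degFr_α isIsometry_β degFr_β baseFrob_α).atLevel M).sgpCap y * (u : Aut ((ofConnectedTemperoidFamily h Q odd_l R ιX K' constEmb constEmb_injective hinvc hinvp α β comm_sCap comm_sCup
      isIsometry_α degFr_α isIsometry_β degFr_β baseFrob_α).atLevel M).BN) * (((ofConnectedTemperoidFamily h Q odd_l R ιX K' constEmb constEmb_injective hinvc hinvp α β comm_sCap comm_sCup
      isIsometry_α degFr_α isIsometry_β degFr_β baseFrob_α).atLevel M).sgpCap y)⁻¹ = u) →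
      ((ofConnectedTemperoidFamily h Q odd_l R ιX K' constEmb constEmb_injective hinvc hinvp α β comm_sCap comm_sCup
      isIsometry_α degFr_α isIsometry_β degFr_β baseFrob_α).atLevel M).unitsToBirat ((ofConnectedTemperoidFamily h Q odd_l R ιX K' constEmb constEmb_injective hinvc hinvp α β comm_sCap comm_sCup
      isIsometry_α degFr_α isIsometry_β degFr_β baseFrob_α).atLevel M).BN u ∈ ((ofConnectedTemperoidFamily h Q odd_l R ιX K' constEmb constEmb_injective hinvc hinvp α β comm_sCap comm_sCup
      isIsometry_α degFr_α isIsometry_β degFr_β baseFrob_α).atLevel M).constEmb.range) :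
    ((ofConnectedTemperoidFamily h Q odd_l R ιX K' constEmb constEmb_injective hinvc hinvp α β comm_sCap comm_sCup
      isIsometry_α degFr_α isIsometry_β degFr_β baseFrob_α).atLevel M).ConstantsActByCyclotome :=
  ThetaFrobenioid.constantsActByCyclotome_ofModelData _ _ _ _ _ _ _ _ _ _ _ _ hconst
    ((atLevel_ofConnectedTemperoidFamily_eq h Q odd_l R ιX K' constEmb constEmb_injective hinvc hinvp α β comm_sCap comm_sCup
      isIsometry_α degFr_α isIsometry_β degFr_β baseFrob_α M).trans
      (ThetaFrobenioid.ofConnectedTemperoidData_eq (T := 𝒯.level M) h Q odd_l (R M) ιX K' (constEmb M) (constEmb_injective M)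
        (hinvc M) (hinvp M))) hgc

/-- **`Facts` at a level `M ∈ E` of the §5 tower over `B^temp(Π^tp_X)⁰` with `A_⊙^bs := Ÿ`, from `hconst` and `hgc` ALONE.**
[cite: MochizukiEtTh2009, §5 p.330–331 (PDF pp.104–105); Lem 5.8 p.331 (PDF p.105)] -/
theorem facts_atLevel_mem_ofConnectedTemperoidYddTower (M : E)
    (hconst : ∀ (e : Aut (R M).BN) (k : K'ˣ), tf.biratAutModel (R M).BN e (constEmb M k) = constEmb M k)
    (hgc : ∀ u : ((ofConnectedTemperoidFamily h Q odd_l R ιX K' constEmb constEmb_injective hinvc hinvp α β comm_sCap comm_sCup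
      isIsometry_α degFr_α isIsometry_β degFr_β baseFrob_α).atLevel M).units ((ofConnectedTemperoidFamily h Q odd_l R ιX K' constEmb constEmb_injective hinvc hinvp α β comm_sCap comm_sCup
      isIsometry_α degFr_α isIsometry_β degFr_β baseFrob_α).atLevel M).BN,
      (∀ y ∈ ((ofConnectedTemperoidFamily h Q odd_l R ιX K' constEmb constEmb_injective hinvc hinvp α β comm_sCap comm_sCup
      isIsometry_α degFr_α isIsometry_β degFr_β baseFrob_α).atLevel M).imPiY,
        ((ofConnectedTemperoidFamily h Q odd_l R ιX K' constEmb constEmb_injective hinvc hinvp α β comm_sCap comm_sCup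
      isIsometry_α degFr_α isIsometry_β degFr_β baseFrob_α).atLevel M).sgpCap y * (u : Aut ((ofConnectedTemperoidFamily h Q odd_l R ιX K' constEmb constEmb_injective hinvc hinvp α β comm_sCap comm_sCup
      isIsometry_α degFr_α isIsometry_β degFr_β baseFrob_α).atLevel M).BN) * (((ofConnectedTemperoidFamily h Q odd_l R ιX K' constEmb constEmb_injective hinvc hinvp α β comm_sCap comm_sCup
      isIsometry_α degFr_α isIsometry_β degFr_β baseFrob_α).atLevel M).sgpCap y)⁻¹ = u) →
      ((ofConnectedTemperoidFamily h Q odd_l R ιX K' constEmb constEmb_injective hinvc hinvp α β comm_sCap comm_sCup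
      isIsometry_α degFr_α isIsometry_β degFr_β baseFrob_α).atLevel M).unitsToBirat ((ofConnectedTemperoidFamily h Q odd_l R ιX K' constEmb constEmb_injective hinvc hinvp α β comm_sCap comm_sCup
      isIsometry_α degFr_α isIsometry_β degFr_β baseFrob_α).atLevel M).BN u ∈ ((ofConnectedTemperoidFamily h Q odd_l R ιX K' constEmb constEmb_injective hinvc hinvp α β comm_sCap comm_sCup
      isIsometry_α degFr_α isIsometry_β degFr_β baseFrob_α).atLevel M).constEmb.range) :
    ((ofConnectedTemperoidFamily h Q odd_l R ιX K' constEmb constEmb_injective hinvc hinvp α β comm_sCap comm_sCup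
      isIsometry_α degFr_α isIsometry_β degFr_β baseFrob_α).atLevel M).Facts :=
  facts_atLevel_ofConnectedTemperoidYddTower h Q odd_l R K' constEmb constEmb_injective hinvc hinvp α β comm_sCap comm_sCup
    isIsometry_α degFr_α isIsometry_β degFr_β baseFrob_α M
    (constantsActByCyclotome_atLevel_ofConnectedTemperoidYddTower h Q odd_l R K' constEmb constEmb_injective hinvc hinvp α β
      comm_sCap comm_sCup isIsometry_α degFr_α isIsometry_β degFr_β baseFrob_α M hconst hgc)

end ThetaFrobenioidTower

end Literature.AnabelianGeometry.EtaleTheta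

end
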